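import Mathlib
import Summits.Ventures.PercRepro2.Defs
import Summits.Ventures.PercRepro2.Independence
import Summits.Ventures.PercRepro2.Harris
import Summits.Ventures.PercRepro2.Graph
import Summits.Ventures.PercRepro2.Exploration
import Summits.Ventures.PercRepro2.Events
import Summits.Ventures.PercRepro2.FourFunctions
import Summits.Ventures.PercRepro2.Induced
import Summits.Ventures.PercRepro2.Frontier
import Summits.Ventures.PercRepro2.ObsIndependence
import Summits.Ventures.PercRepro2.BHK
import Summits.Ventures.PercRepro2.BHKEvents

/-!
# The per-case statement PC1 of the (J1) line and its theorem regime (blind cell PercRepro2,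
p1 g13; lead g23 tri/README «THE PER-CASE SPLIT (PC) OF (J1-K)» 22:33Z, ASSIGNMENTS v12.45)

Five marks `o, a₁, a₂, a₃, b`; `C₁, C₂` the open clusters of `a₁, a₂`; `Q = {a₁ ↮ a₂}`;
`π′_W(o) = P_{G ∖ W}(o ∈ C(a₂))` (`delClusterProb` with the up-set `{S ∋ o}`); `σ_b = 1[b ∈ C₁] −
1[b ∈ C₂]` (`sigmaB`). The lead's per-case split of the host-cluster form `(J1-K)` of the cross
term `(J1)` is `(J1-K) = PC1 + PC2` with

  **`PC1 := Cov_μ(σ_b, F₁(C₁)) ≥ 0`,  `F₁(W) = 1[a₃ ∈ W] · (γ − π′_W(o))`,  `γ = P(o ∈ U ∣ Q, a₃ ∉ U)`**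

(`μ = P(· ∣ Q)`; `PC2` its `a₁ ↔ a₂` mirror) — the RECOMMENDED TARGET of the line: `PC1 ⟹ (J1₁) ⟹
(J1)`. Here **`caseOneFun c₀ c₁ W = 1[a₃ ∈ W] · (c₀ − c₁ · π′_W(o))`** (a general threshold pair)
and the covariance cleared of `P(Q)²` (and of `D` for `γ = D_o / D`) is
**`pcOneExpr c₀ c₁ = P(Q) · E[σ_b F(C₁) 1_Q] − E[σ_b 1_Q] · E[F(C₁) 1_Q]`**; **`PC1`** is
`0 ≤ pcOneExpr D_o D` with `D = P(Q, a₃ ∉ U)`, `D_o = P(Q, a₃ ∉ U, o ∈ U)` (the `jOneB` vocabulary;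
`= D · P(Q)² · Cov_μ(σ_b, F₁(C₁))` when `D, P(Q) > 0`). A definition only, as `HCov`, `TvT`: census
0 failures (lead: n = 5, 18,304 instances per case; n = 6 m ≤ 7, 140,544; binary-extreme palettes,
both NEG-28 witnesses).

THE THEOREM REGIME (the lead's proof shape, kernel-checked here): whenever the host odds never
exceed the threshold — `c₁ · π′_W(o) ≤ c₀` for every host `W ∋ a₃` — the functional is monotone and
nonnegative (**`caseOneFun_monotone`**, **`caseOneFun_nonneg`**), and then
`Cov_μ(1[b ∈ C₁], F(C₁)) ≥ 0` by BHK 1.3 (same cluster, functional: `bhk_same_cluster`) while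
`Cov_μ(1[b ∈ C₂], F(C₁)) ≤ 0` by BHK 1.4 (cross cluster, FUNCTIONAL form — new here:
**`bhk_cross_cluster_fun`**, from the functional tower identity
**`expect_clusterFun_inter_eq_expect`** `E[F(C_s) 1_𝓥(C_t) 1_{s↮t}] = E[F(C_s) g(C_s) 1_{s↮t}]`,
`g = delClusterProb`, exactly as the event form of `BHKEvents.lean`). Hence
**`pcOneExpr_nonneg_of_hosts_le`** (any threshold pair) and **`pc1_of_hosts_le`** /
**`pc1_of_hosts_le_div`** (`PC1` whenever `π′_W(o) ≤ γ` on every host `W ∋ a₃` — 75 % of the n = 5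
instances, lead 22:33Z; the non-monotone hosts, where `F₁` jumps upward at `a₃`, are the open
content; nothing is claimed beyond the regime). -/

namespace Summit.Ventures.PercRepro2

namespace CaseOne

/-! ## The functional tower identity and the functional cross-cluster inequality -/

section Functional
variable {V : Type*} {E : Type*} [Fintype E] [DecidableEq E] [Fintype V] [DecidableEq V]
  {R : Type*} [CommRing R] [LinearOrder R] [IsStrictOrderedRing R]

omit [DecidableEq V] [LinearOrder R] [IsStrictOrderedRing R] in
/-- **Exploring the cluster of `s`, functional form**: for a cluster functional `F` and a family
`𝓥`, `E[F(C_s) · 1_𝓥(C_t) · 1_{s↮t}] = E[F(C_s) · g(C_s) · 1_{s↮t}]` with `g = delClusterProb`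
(`prob_clusterIn_inter_eq_expect` with `1_𝓤` replaced by `F`). -/
theorem expect_clusterFun_inter_eq_expect (p : E → R) (ends : E → Sym2 V) (s t : V)
    (F : Set V → R) (𝓥 : Set (Set V)) :
    expect p (fun ω => F (cluster ends ω s) * 𝓥.indicator 1 (cluster ends ω t) *
        ((connEvent ends s t)ᶜ).indicator 1 ω) =
      expect p (fun ω => F (cluster ends ω s) * delClusterProb p ends t 𝓥 (cluster ends ω s) *
        ((connEvent ends s t)ᶜ).indicator 1 ω) := by
  classical
  let c : Set V → R := fun W => F W * ({W' : Set V | t ∉ W'}.indicator 1 W)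
  let D : Set V → Config E → R := fun W =>
    ({ω | cluster ends (delConfig ends W ω) t ∈ 𝓥} : Set (Config E)).indicator 1
  let Φ : Set V → Config E → R := fun W ω => c W * D W ω
  have hΦ : ∀ W, DependsOn (Φ W) (touches ends W)ᶜ := by
    intro W ω ω' h
    simp only [Φ, D]
    congr 1
    refine dependsOn_indicator (R := R) (fun ω ω' h => ?_) h
    show (cluster ends (delConfig ends W ω) t ∈ 𝓥) = (cluster ends (delConfig ends W ω') t ∈ 𝓥)
    rw [delConfig_congr h]
  have hS : ∀ W : Set V, DependsOn (· ∈ {ω | cluster ends ω s = W}) (touches ends W) :=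
    fun W => dependsOn_clusterEvent ends s W
  have hdisj : ∀ W : Set V, Disjoint (touches ends W) (touches ends W)ᶜ :=
    fun W => disjoint_compl_right
  have hpt : ∀ ω, F (cluster ends ω s) * 𝓥.indicator 1 (cluster ends ω t) *
      ((connEvent ends s t)ᶜ).indicator 1 ω = Φ (cluster ends ω s) ω := by
    intro ω
    simp only [Φ, c, D]
    by_cases hst : t ∈ cluster ends ω s
    · rw [Set.indicator_of_notMem (show ω ∉ (connEvent ends s t)ᶜ from fun h => h hst),
        Set.indicator_of_notMem (show cluster ends ω s ∉ {W' : Set V | t ∉ W'} from fun h => h hst)]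
      simp
    · have e := cluster_delConfig_cluster (ends := ends) (ω := ω) (s := s) hst
      have hmem : ω ∈ {ω' | cluster ends (delConfig ends (cluster ends ω s) ω') t ∈ 𝓥} ↔
          cluster ends ω t ∈ 𝓥 := by
        rw [Set.mem_setOf_eq, e]
      rw [Set.indicator_of_mem (show cluster ends ω s ∈ {W' : Set V | t ∉ W'} from hst),
        Set.indicator_of_mem (show ω ∈ (connEvent ends s t)ᶜ from hst)]
      by_cases h𝓥 : cluster ends ω t ∈ 𝓥
      · rw [Set.indicator_of_mem h𝓥, Set.indicator_of_mem (hmem.2 h𝓥)]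
        simp
      · rw [Set.indicator_of_notMem h𝓥, Set.indicator_of_notMem (fun h => h𝓥 (hmem.1 h))]
        simp
  have hΦexp : ∀ W, expect p (Φ W) = c W * delClusterProb p ends t 𝓥 W := by
    intro W
    simp only [Φ, D]
    rw [expect_const_mul, ← prob_eq_expect_indicator]
    rfl
  have e1 : (fun ω => F (cluster ends ω s) * 𝓥.indicator 1 (cluster ends ω t) *
      ((connEvent ends s t)ᶜ).indicator 1 ω) = fun ω => Φ (cluster ends ω s) ω := funext hpt
  rw [e1, expect_tower p hdisj (S := fun ω => cluster ends ω s) hS hΦ]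
  simp only [hΦexp]
  unfold expect
  refine Finset.sum_congr rfl fun ω _ => ?_
  simp only [c]
  by_cases hst : t ∈ cluster ends ω s
  · rw [Set.indicator_of_notMem (show cluster ends ω s ∉ {W' : Set V | t ∉ W'} from fun h => h hst),
      Set.indicator_of_notMem (show ω ∉ (connEvent ends s t)ᶜ from fun h => h hst)]
    simp
  · rw [Set.indicator_of_mem (show cluster ends ω s ∈ {W' : Set V | t ∉ W'} from hst),
      Set.indicator_of_mem (show ω ∈ (connEvent ends s t)ᶜ from hst)]
    simp

omit [DecidableEq V] in
/-- **BHK, different clusters, functional form** (BHK06 Thm 1.4 with a nonnegative monotone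
functional of `C_s` against an up-set of `C_t`, multiplied out):
`E[F(C_s) 1_𝓥(C_t) 1_{s↮t}] · P(s↮t) ≤ E[F(C_s) 1_{s↮t}] · P(C_t ∈ 𝓥, s↮t)`. -/
theorem bhk_cross_cluster_fun (p : E → R) (hp : IsProbVec p) (ends : E → Sym2 V) (s t : V)
    {F : Set V → R} (hF : Monotone F) (hF0 : ∀ S, 0 ≤ F S) {𝓥 : Set (Set V)}
    (h𝓥 : IsUpperSet 𝓥) :
    expect p (fun ω => F (cluster ends ω s) * 𝓥.indicator 1 (cluster ends ω t) *
        ((connEvent ends s t)ᶜ).indicator 1 ω) * prob p (connEvent ends s t)ᶜ ≤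
      expect p (fun ω => F (cluster ends ω s) * ((connEvent ends s t)ᶜ).indicator 1 ω) *
        prob p (clusterInEvent ends t 𝓥 ∩ (connEvent ends s t)ᶜ) := by
  classical
  set g := delClusterProb p ends t 𝓥 with hg
  have hg_anti : Antitone g := delClusterProb_anti p hp ends t h𝓥
  have hg1 : ∀ W, g W ≤ 1 := delClusterProb_le_one p hp ends t 𝓥
  have eUV := expect_clusterFun_inter_eq_expect p ends s t F 𝓥
  have eV := prob_clusterIn_inter_eq_expect p ends s t Set.univ 𝓥
  simp only [Set.indicator_univ, Pi.one_apply, one_mul] at eV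
  have eV' : clusterInEvent ends s Set.univ ∩ clusterInEvent ends t 𝓥 ∩ (connEvent ends s t)ᶜ =
      clusterInEvent ends t 𝓥 ∩ (connEvent ends s t)ᶜ := by
    ext ω; simp [clusterInEvent]
  rw [eV'] at eV
  have hF₂ : Monotone (fun W => 1 - g W) := fun W W' h => by
    have := hg_anti h
    simp only
    linarith
  have hF₂0 : ∀ W, 0 ≤ 1 - g W := fun W => by linarith [hg1 W]
  have key := bhk_same_cluster p hp ends s t hF hF₂ hF0 hF₂0
  -- expand `(1 − g)` in both factors
  have e2 : expect p (fun ω => (1 - g (cluster ends ω s)) * ((connEvent ends s t)ᶜ).indicator 1 ω) =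
      prob p (connEvent ends s t)ᶜ -
        expect p (fun ω => g (cluster ends ω s) * ((connEvent ends s t)ᶜ).indicator 1 ω) := by
    rw [prob_eq_expect_indicator, ← expect_sub]
    congr 1
    funext ω
    simp [sub_mul]
  have e3 : expect p (fun ω => F (cluster ends ω s) * (1 - g (cluster ends ω s)) *
      ((connEvent ends s t)ᶜ).indicator 1 ω) =
      expect p (fun ω => F (cluster ends ω s) * ((connEvent ends s t)ᶜ).indicator 1 ω) -
        expect p (fun ω => F (cluster ends ω s) * g (cluster ends ω s) *
          ((connEvent ends s t)ᶜ).indicator 1 ω) := by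
    rw [← expect_sub]
    congr 1
    funext ω
    simp only [Pi.sub_apply]
    ring
  rw [e2, e3] at key
  rw [eUV, eV]
  nlinarith [key]

end Functional

/-! ## The case-1 functional, the side sign and the cleared covariance -/

section Defs
variable {V : Type*} {E : Type*} [Fintype E] [DecidableEq E] {R : Type*} [CommRing R]

/-- **The case-1 functional with threshold pair `(c₀, c₁)`**:
`F(W) = 1[a₃ ∈ W] · (c₀ − c₁ · π′_W(o))`, `π′_W(o) = P_{G ∖ W}(o ∈ C(a₂))`; the lead's
`F₁(R) = 1[a₃ ∈ R](γ − π′_R(o))` is the pair `(D_o, D)` divided by `D`. -/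
noncomputable def caseOneFun (p : E → R) (ends : E → Sym2 V) (o a₂ a₃ : V) (c₀ c₁ : R)
    (W : Set V) : R :=
  ({W' : Set V | a₃ ∈ W'}).indicator 1 W * (c₀ - c₁ * delClusterProb p ends a₂ {S | o ∈ S} W)

/-- **The side sign** `σ_b = 1[b ∈ C₁] − 1[b ∈ C₂]`, written with cluster-membership indicators. -/
noncomputable def sigmaB (ends : E → Sym2 V) (a₁ a₂ b : V) (ω : Config E) : R :=
  ({S : Set V | b ∈ S}).indicator 1 (cluster ends ω a₁) -
    ({S : Set V | b ∈ S}).indicator 1 (cluster ends ω a₂)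

/-- **The cleared per-case covariance** `P(Q) · E[σ_b F(C₁) 1_Q] − E[σ_b 1_Q] · E[F(C₁) 1_Q]`
(`= P(Q)² · Cov_μ(σ_b, F(C₁))`, `Q = {a₁ ↮ a₂}`, `F = caseOneFun c₀ c₁`). -/
noncomputable def pcOneExpr (p : E → R) (ends : E → Sym2 V) (o a₁ a₂ a₃ b : V) (c₀ c₁ : R) : R :=
  prob p (connEvent ends a₁ a₂)ᶜ *
      expect p (fun ω => sigmaB ends a₁ a₂ b ω *
        caseOneFun p ends o a₂ a₃ c₀ c₁ (cluster ends ω a₁) *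
        ((connEvent ends a₁ a₂)ᶜ).indicator 1 ω) -
    expect p (fun ω => sigmaB ends a₁ a₂ b ω * ((connEvent ends a₁ a₂)ᶜ).indicator 1 ω) *
      expect p (fun ω => caseOneFun p ends o a₂ a₃ c₀ c₁ (cluster ends ω a₁) *
        ((connEvent ends a₁ a₂)ᶜ).indicator 1 ω)

/-- `D = P(Q, a₃ ∉ U)` (`jOneB` vocabulary). -/
noncomputable def Dpd (p : E → R) (ends : E → Sym2 V) (a₁ a₂ a₃ : V) : R :=
  prob p ((connEvent ends a₁ a₃)ᶜ ∩ (connEvent ends a₂ a₃)ᶜ ∩ (connEvent ends a₁ a₂)ᶜ)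

/-- `D_o = P(Q, a₃ ∉ U, o ∈ U)` (`jOneB` vocabulary); `γ = D_o / D`. -/
noncomputable def Dpdo (p : E → R) (ends : E → Sym2 V) (o a₁ a₂ a₃ : V) : R :=
  prob p ((connEvent ends a₁ o ∪ connEvent ends a₂ o) ∩ (connEvent ends a₁ a₃)ᶜ ∩
    (connEvent ends a₂ a₃)ᶜ ∩ (connEvent ends a₁ a₂)ᶜ)

omit [Fintype E] [DecidableEq E] in
/-- The side sign in the `connEvent` vocabulary: `σ_b = 1_{a₁ ↔ b} − 1_{a₂ ↔ b}`. -/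
lemma sigmaB_eq (ends : E → Sym2 V) (a₁ a₂ b : V) (ω : Config E) :
    sigmaB (R := R) ends a₁ a₂ b ω =
      (connEvent ends a₁ b).indicator 1 ω - (connEvent ends a₂ b).indicator 1 ω := by
  unfold sigmaB
  have h : ∀ x : V, ({S : Set V | b ∈ S}).indicator (1 : Set V → R) (cluster ends ω x) =
      (connEvent ends x b).indicator 1 ω := by
    intro x
    by_cases hx : Conn ends ω x b
    · simp only [Set.indicator_of_mem (show cluster ends ω x ∈ {S : Set V | b ∈ S} from hx),
        Set.indicator_of_mem (show ω ∈ connEvent ends x b from hx), Pi.one_apply]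
    · simp only [Set.indicator_of_notMem (show cluster ends ω x ∉ {S : Set V | b ∈ S} from hx),
        Set.indicator_of_notMem (show ω ∉ connEvent ends x b from hx)]
  rw [h, h]

end Defs

section PCDef
variable {V : Type*} {E : Type*} [Fintype E] [DecidableEq E] {R : Type*} [CommRing R]
  [LinearOrder R]

/-- **PC1 (the per-case statement of the (J1) line, cleared)**: `0 ≤ pcOneExpr D_o D`, i.e.
`Cov_μ(σ_b, 1[a₃ ∈ C₁] (γ − π′_{C₁}(o))) ≥ 0` with `γ = D_o / D` (when `D, P(Q) > 0`). A definition
only (census 0 failures; `PC1 ⟹ (J1₁) ⟹ (J1)`); a THEOREM in the monotone-host regime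
(`pc1_of_hosts_le`). -/
def PC1 (p : E → R) (ends : E → Sym2 V) (o a₁ a₂ a₃ b : V) : Prop :=
  0 ≤ pcOneExpr p ends o a₁ a₂ a₃ b (Dpdo p ends o a₁ a₂ a₃) (Dpd p ends a₁ a₂ a₃)

end PCDef

/-! ## The theorem regime: monotone hosts -/

section Regime
variable {V : Type*} {E : Type*} [Fintype E] [DecidableEq E] [Fintype V] [DecidableEq V]
  {R : Type*} [CommRing R] [LinearOrder R] [IsStrictOrderedRing R]

omit [Fintype V] [DecidableEq V] in
/-- `{S ∋ v}` is an up-set of vertex sets. -/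
private lemma isUpperSet_mem (v : V) : IsUpperSet {S : Set V | v ∈ S} :=
  fun _ _ h hv => h hv

omit [Fintype V] [DecidableEq V] in
/-- **Monotone hosts make the functional monotone**: if `c₁ ≥ 0` and `c₁ · π′_W(o) ≤ c₀` for every
host `W ∋ a₃`, then `caseOneFun c₀ c₁` is monotone in `W`. -/
theorem caseOneFun_monotone (p : E → R) (hp : IsProbVec p) (ends : E → Sym2 V) (o a₂ a₃ : V)
    {c₀ c₁ : R} (hc₁ : 0 ≤ c₁)
    (h : ∀ W : Set V, a₃ ∈ W → c₁ * delClusterProb p ends a₂ {S | o ∈ S} W ≤ c₀) :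
    Monotone (caseOneFun p ends o a₂ a₃ c₀ c₁) := by
  intro W W' hWW'
  unfold caseOneFun
  have hanti := delClusterProb_anti p hp ends a₂ (isUpperSet_mem (V := V) o) hWW'
  by_cases hW : a₃ ∈ W
  · have hW' : a₃ ∈ W' := hWW' hW
    rw [Set.indicator_of_mem (show W ∈ {W' : Set V | a₃ ∈ W'} from hW),
      Set.indicator_of_mem (show W' ∈ {W' : Set V | a₃ ∈ W'} from hW')]
    simp only [Pi.one_apply, one_mul]
    have := mul_le_mul_of_nonneg_left hanti hc₁
    linarith
  · rw [Set.indicator_of_notMem (show W ∉ {W' : Set V | a₃ ∈ W'} from hW)]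
    simp only [zero_mul]
    by_cases hW' : a₃ ∈ W'
    · rw [Set.indicator_of_mem (show W' ∈ {W' : Set V | a₃ ∈ W'} from hW')]
      simp only [Pi.one_apply, one_mul]
      linarith [h W' hW']
    · rw [Set.indicator_of_notMem (show W' ∉ {W' : Set V | a₃ ∈ W'} from hW')]
      simp

omit [Fintype V] [DecidableEq V] in
/-- **Monotone hosts make the functional nonnegative.** -/
theorem caseOneFun_nonneg (p : E → R) (ends : E → Sym2 V) (o a₂ a₃ : V) {c₀ c₁ : R}
    (h : ∀ W : Set V, a₃ ∈ W → c₁ * delClusterProb p ends a₂ {S | o ∈ S} W ≤ c₀) (W : Set V) :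
    0 ≤ caseOneFun p ends o a₂ a₃ c₀ c₁ W := by
  unfold caseOneFun
  by_cases hW : a₃ ∈ W
  · rw [Set.indicator_of_mem (show W ∈ {W' : Set V | a₃ ∈ W'} from hW)]
    simp only [Pi.one_apply, one_mul]
    linarith [h W hW]
  · rw [Set.indicator_of_notMem (show W ∉ {W' : Set V | a₃ ∈ W'} from hW)]
    simp

omit [DecidableEq V] in
/-- **The per-case covariance is nonnegative in the monotone-host regime** (the lead's proof
shape): for `c₁ ≥ 0` and `c₁ · π′_W(o) ≤ c₀` on every host `W ∋ a₃`,
`0 ≤ P(Q) · E[σ_b F(C₁) 1_Q] − E[σ_b 1_Q] · E[F(C₁) 1_Q]` — BHK 1.3 (same cluster) for the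
`b ∈ C₁` half, the functional BHK 1.4 (`bhk_cross_cluster_fun`) for the `b ∈ C₂` half. -/
theorem pcOneExpr_nonneg_of_hosts_le (p : E → R) (hp : IsProbVec p) (ends : E → Sym2 V)
    (o a₁ a₂ a₃ b : V) {c₀ c₁ : R} (hc₁ : 0 ≤ c₁)
    (h : ∀ W : Set V, a₃ ∈ W → c₁ * delClusterProb p ends a₂ {S | o ∈ S} W ≤ c₀) :
    0 ≤ pcOneExpr p ends o a₁ a₂ a₃ b c₀ c₁ := by
  classical
  set F := caseOneFun p ends o a₂ a₃ c₀ c₁ with hFdef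
  have hF : Monotone F := caseOneFun_monotone p hp ends o a₂ a₃ hc₁ h
  have hF0 : ∀ W, 0 ≤ F W := caseOneFun_nonneg p ends o a₂ a₃ h
  have hIb_mono : Monotone (({S : Set V | b ∈ S}).indicator (1 : Set V → R)) :=
    monotone_indicator_one_of_isUpperSet (isUpperSet_mem (V := V) b)
  have hIb0 : ∀ S, 0 ≤ ({S : Set V | b ∈ S}).indicator (1 : Set V → R) S :=
    fun _ => Set.indicator_apply_nonneg fun _ => zero_le_one
  -- same cluster: `E[1_b(C₁) 1_Q] · E[F 1_Q] ≤ E[1_b(C₁) F 1_Q] · P(Q)`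
  have same := bhk_same_cluster p hp ends a₁ a₂ hIb_mono hF hIb0 hF0
  -- cross cluster: `E[F 1_b(C₂) 1_Q] · P(Q) ≤ E[F 1_Q] · P(C₂ ∋ b, Q)`
  have cross := bhk_cross_cluster_fun p hp ends a₁ a₂ hF hF0 (isUpperSet_mem (V := V) b)
  -- `P(C₂ ∋ b, Q) = E[1_b(C₂) 1_Q]`
  have eP : prob p (clusterInEvent ends a₂ {S : Set V | b ∈ S} ∩ (connEvent ends a₁ a₂)ᶜ) =
      expect p (fun ω => ({S : Set V | b ∈ S}).indicator (1 : Set V → R) (cluster ends ω a₂) *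
        ((connEvent ends a₁ a₂)ᶜ).indicator 1 ω) := by
    rw [prob_eq_expect_indicator]
    congr 1
    funext ω
    by_cases h1 : b ∈ cluster ends ω a₂
    · by_cases h2 : ω ∈ (connEvent ends a₁ a₂)ᶜ
      · rw [Set.indicator_of_mem (show ω ∈ clusterInEvent ends a₂ {S : Set V | b ∈ S} ∩
            (connEvent ends a₁ a₂)ᶜ from ⟨h1, h2⟩),
          Set.indicator_of_mem (show cluster ends ω a₂ ∈ {S : Set V | b ∈ S} from h1),
          Set.indicator_of_mem h2]
        simp
      · rw [Set.indicator_of_notMem (show ω ∉ clusterInEvent ends a₂ {S : Set V | b ∈ S} ∩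
            (connEvent ends a₁ a₂)ᶜ from fun h => h2 h.2), Set.indicator_of_notMem h2]
        simp
    · rw [Set.indicator_of_notMem (show ω ∉ clusterInEvent ends a₂ {S : Set V | b ∈ S} ∩
          (connEvent ends a₁ a₂)ᶜ from fun h => h1 h.1),
        Set.indicator_of_notMem (show cluster ends ω a₂ ∉ {S : Set V | b ∈ S} from h1)]
      simp
  rw [eP] at cross
  -- expand `σ_b` in the two expectations of `pcOneExpr`
  unfold pcOneExpr
  have e1 : expect p (fun ω => sigmaB ends a₁ a₂ b ω * F (cluster ends ω a₁) *
      ((connEvent ends a₁ a₂)ᶜ).indicator 1 ω) =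
      expect p (fun ω => ({S : Set V | b ∈ S}).indicator (1 : Set V → R) (cluster ends ω a₁) *
          F (cluster ends ω a₁) * ((connEvent ends a₁ a₂)ᶜ).indicator 1 ω) -
        expect p (fun ω => F (cluster ends ω a₁) *
          ({S : Set V | b ∈ S}).indicator (1 : Set V → R) (cluster ends ω a₂) *
          ((connEvent ends a₁ a₂)ᶜ).indicator 1 ω) := by
    rw [← expect_sub]
    congr 1
    funext ω
    simp only [Pi.sub_apply, sigmaB]
    ring
  have e2 : expect p (fun ω => sigmaB ends a₁ a₂ b ω * ((connEvent ends a₁ a₂)ᶜ).indicator 1 ω) =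
      expect p (fun ω => ({S : Set V | b ∈ S}).indicator (1 : Set V → R) (cluster ends ω a₁) *
          ((connEvent ends a₁ a₂)ᶜ).indicator 1 ω) -
        expect p (fun ω => ({S : Set V | b ∈ S}).indicator (1 : Set V → R) (cluster ends ω a₂) *
          ((connEvent ends a₁ a₂)ᶜ).indicator 1 ω) := by
    rw [← expect_sub]
    congr 1
    funext ω
    simp only [Pi.sub_apply, sigmaB]
    ring
  rw [e1, e2]
  nlinarith [same, cross]

omit [DecidableEq V] in
/-- **`PC1` in the monotone-host regime**: if `D · π′_W(o) ≤ D_o` for every host `W ∋ a₃`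
(i.e. `π′_W(o) ≤ γ` when `D > 0`), then `PC1`. -/
theorem pc1_of_hosts_le (p : E → R) (hp : IsProbVec p) (ends : E → Sym2 V) (o a₁ a₂ a₃ b : V)
    (h : ∀ W : Set V, a₃ ∈ W →
      Dpd p ends a₁ a₂ a₃ * delClusterProb p ends a₂ {S | o ∈ S} W ≤ Dpdo p ends o a₁ a₂ a₃) :
    PC1 p ends o a₁ a₂ a₃ b := by
  have hD : 0 ≤ Dpd p ends a₁ a₂ a₃ := prob_nonneg hp _
  unfold PC1
  exact pcOneExpr_nonneg_of_hosts_le p hp ends o a₁ a₂ a₃ b hD h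

end Regime

section RegimeDiv
variable {V : Type*} {E : Type*} [Fintype E] [DecidableEq E] [Fintype V] [DecidableEq V]
  {R : Type*} [Field R] [LinearOrder R] [IsStrictOrderedRing R]

omit [DecidableEq V] in
/-- **`PC1` in the monotone-host regime, threshold form**: if `D > 0` and `π′_W(o) ≤ γ = D_o / D`
for every host `W ∋ a₃`, then `PC1`. -/
theorem pc1_of_hosts_le_div (p : E → R) (hp : IsProbVec p) (ends : E → Sym2 V) (o a₁ a₂ a₃ b : V)
    (hD : 0 < Dpd p ends a₁ a₂ a₃)
    (h : ∀ W : Set V, a₃ ∈ W →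
      delClusterProb p ends a₂ {S | o ∈ S} W ≤ Dpdo p ends o a₁ a₂ a₃ / Dpd p ends a₁ a₂ a₃) :
    PC1 p ends o a₁ a₂ a₃ b := by
  refine pc1_of_hosts_le p hp ends o a₁ a₂ a₃ b fun W hW => ?_
  have := h W hW
  rw [le_div_iff₀ hD] at this
  linarith

end RegimeDiv

end CaseOne

end Summit.Ventures.PercRepro2
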